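import Literature.MathematicalPhysics.QuantumFieldTheory.Balaban1983to89.T4AxialGaugeSmallField

/-!
# T4 — the axial gauge on a box of the torus ROOTED AT AN ARBITRARY POINT OF THE BOX (e.g. its centre), and the two-sided
# lattice non-abelian Poincaré lemma for it

Kernel certificate.  The printed sentences formalised: [Balaban1985Averaging] pp. 24–25 «`v₀(x) := V(Γ_{y,x})` … for `b ⊂ Δ(p′)` we have
`|V₀,b − 1| < |b₋ − y|α₀`» (the axial gauge based at ANY point `y` and its bond bound) and [Balaban1985RegularSpaces] (1.129) p. 98 «`|U₀′(x,x′) − 1| ≤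
|x − y|·2L²α₀ …` where `y` is a center of `□̃^{(k)}`»; the word lemmas of §1 are bookkeeping of [Balaban1985Averaging] (9) p. 19 (lattice words
and parallel transport).  `T4AxialGaugeSmallField` (lineage pv26) transported B7/B8's tree-gauge
machinery to the torus carrier with the gauge ROOTED AT THE LOWER CORNER `lo` of the box (`axialGauge U lo hi`, paths
`treeWord (x − lo)` of FORWARD letters; its bond bound `dist1_axial_bond_le_sharp` asks `lo ≤ y ≤ x`).  Bałaban's Sect. F
representative is axial «with a center at the point y» ([Balaban1985Variational] (147); [Balaban1985RegularSpaces] p. 98,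
(1.129): `|U′(x,x′) − 1| ≤ |x − y|·2L²α₀`), i.e. the tree paths run from an INTERIOR root in both directions.  This file adds the
root as a parameter — `axialGaugeAt U lo hi r` (`= axialGauge U lo hi` at `r = lo`) — and proves the TWO-SIDED bond bound
`dist1 ((U^{h_r})(x, x + e_μ)) ≤ (Σ_{κ<μ}|x_κ − r_κ|)·δ ≤ |x − r|₁·δ` for every root `r` and bond of the box, from the plaquette
hypothesis on the box alone.  The new ingredient is pure word bookkeeping: along the SIGNED tree word `treeWord v` every
intermediate point lies coordinatewise between the endpoints (`tw_split_between`), so every elementary loop of the located ladder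
(`T4AxialGaugeSmallField.dist1_hol_ladder_le_local`, sign-agnostic) is a plaquette of the box, a backward letter's loop being the
conjugated inverse plaquette one step back (`dist1_hol_lplaqWord_le`).  The group-theoretic identity is B8's
`axial_bond_eq_sharp` (valid for every root), used BY NAME; nothing of `T4AxialGaugeSmallField` ∕ `B7Prop1Explicit` ∕
`B8Lemma1NonAbelian` is modified or re-proved.  Nothing printed is asserted; no `sorry`; ONE `def` (`axialGaugeAt`), no
`instance`, no `notation`.

CONTENTS.  §1 words: `seg_eq_replicate`, `fst_mem_of_mem_tw`, `disp_apply_eq_zero_of_fst_ne`, ★ `tw_split_between`,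
`treeWord_split_between`.  §2 group level on `ℤ^d`: `dist1_hol_lplaqWord_le` (any letter), ★★ `dist1_axial_bond_le_sharp_rooted`,
`dist1_axial_bond_le_rooted` (`|x − r|₁`), `l1_lowPart_le_of_abs_le`, `dist1_axial_bond_le_rooted_uniform` (`(d−1)·h·a` when
`|x − r|_∞ ≤ h`).  §3 torus: `axialGaugeAt` + `axialGaugeAt_castSite` ∕ `axialGaugeAt_eq_one` ∕ `axialGauge_eq_axialGaugeAt` ∕
`gaugeAct_axialGaugeAt_castSite`, ★★ `dist1_gaugeAct_axialGaugeAt_le` (sharp), `dist1_gaugeAct_axialGaugeAt_le_l1`,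
`dist1_gaugeAct_axialGaugeAt_le_uniform`, `gaugeAct_axialGaugeAt_eq_one` (tree bonds).
-/

open Set

namespace Literature.MathematicalPhysics.QuantumFieldTheory.Balaban1983to89.T4AxialGaugeRooted

open B7Prop1Explicit (Letter e e_apply disp disp_nil disp_cons disp_append disp_replicate hol hol_nil hol_cons stepHol stepHol_true
  stepHol_false gaugeAct hol_gaugeAct_closed treeWord disp_treeWord l1 length_treeWord plaqWord lplaqWord lplaqWord_true
  disp_lplaqWord seg seg_natCast seg_neg_natCast mem_seg ladder axialFn)
open B8Lemma1NonAbelian (lowPart lowPart_apply l1_lowPart_eq e_nonneg zsmul_e_apply tw tw_nil tw_cons treeWord_eq_tw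
  ne_zero_of_mem_treeWord axial_bond_eq_sharp axial_treeBond_eq_one)
open B11GaugeGlue (dist1_conj_inv)
open T4AxialGaugeSmallField (BoxPlaqSmall dist1_hol_ladder_le_local castSite castSite_add_e pull pull_apply boxPlaqs boxPlaqSmall_pull
  castSite_injOn_box axialGauge)

/-! ## §1  Words: along a signed tree word every intermediate point lies between the endpoints -/

section Words

variable {d : ℕ}

/-- A straight segment is a constant word: `|n|` copies of the letter `(κ, 0 ≤ n)`. [cite: Balaban1985Averaging, (9) p.19 (bookkeeping)] -/
theorem seg_eq_replicate (κ : Fin d) (n : ℤ) : seg κ n = List.replicate n.natAbs (κ, decide (0 ≤ n)) := by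
  rcases Int.eq_nat_or_neg n with ⟨m, rfl | rfl⟩
  · simp [seg_natCast]
  · rw [seg_neg_natCast, Int.natAbs_neg, Int.natAbs_natCast]
    rcases Nat.eq_zero_or_pos m with rfl | hm
    · simp
    · have : ¬ (0 : ℤ) ≤ -(m : ℤ) := by omega
      rw [decide_eq_false this]

/-- Letters of `tw ks v` move coordinates listed in `ks`. [cite: Balaban1985Averaging, (9) p.19 (bookkeeping)] -/
theorem fst_mem_of_mem_tw {ks : List (Fin d)} {v : Fin d → ℤ} {l : Letter d} (hl : l ∈ tw ks v) : l.1 ∈ ks := by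
  induction ks with
  | nil => simp [tw] at hl
  | cons κ ks ih =>
    rw [tw_cons, List.mem_append] at hl
    rcases hl with h | h
    · rw [mem_seg h]; simp
    · exact List.mem_cons_of_mem κ (ih h)

/-- A word none of whose letters moves coordinate `i` has no displacement in coordinate `i`. [cite: Balaban1985Averaging, (9) p.19 (bookkeeping)] -/
theorem disp_apply_eq_zero_of_fst_ne {w : List (Letter d)} {i : Fin d} (h : ∀ l ∈ w, l.1 ≠ i) : disp w i = 0 := by
  induction w with
  | nil => simp
  | cons l w ih =>
    rw [disp_cons, Pi.add_apply, ih fun l' hl' => h l' (List.mem_cons_of_mem l hl')]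
    obtain ⟨κ, b⟩ := l
    have hκ : κ ≠ i := h (κ, b) (by simp)
    cases b <;> simp [B7Prop1Explicit.Letter.vec, e_apply, Ne.symm hκ]

/-- A letter's vector in its own coordinate is `±1`, elsewhere `0`. [cite: Balaban1985Averaging, (9) p.19 (bookkeeping)] -/
theorem vec_apply (l : Letter d) (i : Fin d) : l.vec i = if i = l.1 then (if l.2 then 1 else -1) else 0 := by
  obtain ⟨κ, b⟩ := l
  by_cases hi : i = κ
  · subst hi; cases b <;> simp [e_apply]
  · cases b <;> simp [e_apply, hi]

/-- ★ **THE WALK LEMMA**: along the tree word `tw ks v` (directions `ks` without repetition) every intermediate point, and the point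
after the next letter, lies coordinatewise between `0` and `v`. [cite: Balaban1985Averaging, (9) p.19 (bookkeeping)] -/
theorem tw_split_between {ks : List (Fin d)} (hks : ks.Nodup) (v : Fin d → ℤ) :
    ∀ (w₁ w₂ : List (Letter d)) (l : Letter d), tw ks v = w₁ ++ l :: w₂ →
      (∀ i, min 0 (v i) ≤ disp w₁ i ∧ disp w₁ i ≤ max 0 (v i)) ∧
      (∀ i, min 0 (v i) ≤ (disp w₁ + l.vec) i ∧ (disp w₁ + l.vec) i ≤ max 0 (v i)) := by
  induction ks with
  | nil => intro w₁ w₂ l h; simp [tw] at h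
  | cons κ ks ih =>
    intro w₁ w₂ l h
    obtain ⟨hκ, hks'⟩ := List.nodup_cons.mp hks
    rw [tw_cons] at h
    -- letters of the tail do not move coordinate `κ`
    have htail : ∀ l' ∈ tw ks v, l'.1 ≠ κ := fun l' hl' heq => hκ (heq ▸ fst_mem_of_mem_tw hl')
    have h0min : ∀ i, min 0 (v i) ≤ 0 := fun i => min_le_left _ _
    have h0max : ∀ i, (0 : ℤ) ≤ max 0 (v i) := fun i => le_max_left _ _
    have hvmin : ∀ i, min 0 (v i) ≤ v i := fun i => min_le_right _ _
    have hvmax : ∀ i, v i ≤ max 0 (v i) := fun i => le_max_right _ _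
    rcases List.append_eq_append_iff.mp h with ⟨a', hw₁, hrest⟩ | ⟨c', hseg, hrest⟩
    · -- the split is inside the tail: the segment in `κ` has been walked completely
      obtain ⟨ih1, ih2⟩ := ih hks' a' w₂ l hrest
      have hl : l.1 ≠ κ := htail l (by rw [hrest]; simp)
      have ha' : disp a' κ = 0 := disp_apply_eq_zero_of_fst_ne fun l' hl' => htail l' (by rw [hrest]; simp [hl'])
      have hlκ : l.vec κ = 0 := by rw [vec_apply, if_neg (Ne.symm hl)]
      rw [hw₁, disp_append, B7Prop1Explicit.disp_seg]
      refine ⟨fun i => ?_, fun i => ?_⟩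
      · by_cases hi : i = κ
        · subst hi; rw [Pi.add_apply, zsmul_e_apply, if_pos rfl, ha', add_zero]; exact ⟨hvmin i, hvmax i⟩
        · rw [Pi.add_apply, zsmul_e_apply, if_neg hi, zero_add]; exact ih1 i
      · by_cases hi : i = κ
        · subst hi
          rw [Pi.add_apply, Pi.add_apply, zsmul_e_apply, if_pos rfl, ha', hlκ, add_zero, add_zero]
          exact ⟨hvmin i, hvmax i⟩
        · have := ih2 i
          rw [Pi.add_apply] at this
          rw [Pi.add_apply, Pi.add_apply, zsmul_e_apply, if_neg hi, zero_add]; exact this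
    · rcases List.cons_eq_append_iff.mp hrest with ⟨hc', htw⟩ | ⟨c'', hc', hw₂⟩
      · -- the split is exactly at the start of the tail
        subst hc'
        rw [List.append_nil] at hseg
        obtain ⟨-, ih2⟩ := ih hks' [] w₂ l (by simpa using htw)
        have hl : l.1 ≠ κ := htail l (by rw [htw]; simp)
        have hlκ : l.vec κ = 0 := by rw [vec_apply, if_neg (Ne.symm hl)]
        rw [← hseg, B7Prop1Explicit.disp_seg]
        refine ⟨fun i => ?_, fun i => ?_⟩
        · by_cases hi : i = κ
          · subst hi; rw [zsmul_e_apply, if_pos rfl]; exact ⟨hvmin i, hvmax i⟩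
          · rw [zsmul_e_apply, if_neg hi]; exact ⟨h0min i, h0max i⟩
        · by_cases hi : i = κ
          · subst hi; rw [Pi.add_apply, zsmul_e_apply, if_pos rfl, hlκ, add_zero]; exact ⟨hvmin i, hvmax i⟩
          · have := ih2 i
            rw [Pi.add_apply, disp_nil, Pi.zero_apply, zero_add] at this
            rw [Pi.add_apply, zsmul_e_apply, if_neg hi, zero_add]; exact this
      · -- the split is inside the segment in direction `κ`
        subst hc'
        rw [seg_eq_replicate] at hseg
        set n := (v κ).natAbs with hn
        set a : Letter d := (κ, decide (0 ≤ v κ)) with ha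
        have hmem : ∀ l' ∈ w₁ ++ l :: c'', l' = a := fun l' hl' => by
          rw [← hseg] at hl'; exact (List.mem_replicate.mp hl').2
        have hl : l = a := hmem l (by simp)
        have hw₁ : w₁ = List.replicate w₁.length a :=
          List.eq_replicate_iff.mpr ⟨rfl, fun b hb => hmem b (by simp [hb])⟩
        have hlen : w₁.length + 1 ≤ n := by
          have := congrArg List.length hseg
          rw [List.length_replicate, List.length_append, List.length_cons] at this; omega
        set m := w₁.length with hm
        rw [hw₁, disp_replicate, hl]
        have hva : ∀ i, a.vec i = if i = κ then (if (0 ≤ v κ) then 1 else -1) else 0 := fun i => by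
          rw [vec_apply]; simp [a]
        have hnz : ((n : ℕ) : ℤ) = |v κ| := by rw [hn]; exact Int.natCast_natAbs (v κ)
        have key : ∀ (t : ℕ), t ≤ n → min 0 (v κ) ≤ (t : ℤ) * (if (0 ≤ v κ) then 1 else -1) ∧
            (t : ℤ) * (if (0 ≤ v κ) then 1 else -1) ≤ max 0 (v κ) := by
          intro t ht
          by_cases hs : 0 ≤ v κ
          · rw [if_pos hs, mul_one, min_eq_left hs, max_eq_right hs]
            rw [abs_of_nonneg hs] at hnz
            constructor <;> omega
          · have hs' : v κ < 0 := not_le.mp hs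
            rw [if_neg hs, mul_neg, mul_one, min_eq_right hs'.le, max_eq_left hs'.le]
            rw [abs_of_neg hs'] at hnz
            constructor <;> omega
        refine ⟨fun i => ?_, fun i => ?_⟩
        · rw [Pi.smul_apply, smul_eq_mul, hva]
          by_cases hi : i = κ
          · subst hi; rw [if_pos rfl]; exact key m (by omega)
          · rw [if_neg hi, mul_zero]; exact ⟨h0min i, h0max i⟩
        · rw [Pi.add_apply, Pi.smul_apply, smul_eq_mul, hva]
          by_cases hi : i = κ
          · subst hi; rw [if_pos rfl]
            have := key (m + 1) hlen
            rw [Nat.cast_succ, add_mul, one_mul] at this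
            exact this
          · rw [if_neg hi, mul_zero, add_zero]; exact ⟨h0min i, h0max i⟩

/-- The walk lemma for the full tree word `treeWord v = tw [d−1, …, 0] v`. [cite: Balaban1985Averaging, (9) p.19 (bookkeeping)] -/
theorem treeWord_split_between (v : Fin d → ℤ) {w₁ w₂ : List (Letter d)} {l : Letter d} (h : treeWord v = w₁ ++ l :: w₂) :
    (∀ i, min 0 (v i) ≤ disp w₁ i ∧ disp w₁ i ≤ max 0 (v i)) ∧
    (∀ i, min 0 (v i) ≤ (disp w₁ + l.vec) i ∧ (disp w₁ + l.vec) i ≤ max 0 (v i)) :=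
  tw_split_between (List.nodup_reverse.mpr (List.nodup_finRange d)) v w₁ w₂ l (by rw [← treeWord_eq_tw]; exact h)

end Words

/-! ## §2  Group level on `ℤ^d`: the two-sided sharp tree-gauge bound for an arbitrary root -/

section GroupLevel

variable {d : ℕ} {G : Type*} [GaugeGroup G]

/-- The elementary loop of ANY letter `l` (`l.1 ≠ μ`) at `p` is within `a` of `1` once its plaquette lies in the box: for a forward
letter it IS the plaquette at `p`; for a backward letter `−e_κ` it is the inverse plaquette at `p − e_κ` conjugated by a bond
variable.
[cite: Balaban1985Averaging, pp.24–25; Balaban1985RegularSpaces, (1.129) p.98] -/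
theorem dist1_hol_lplaqWord_le (V : (Fin d → ℤ) → Fin d → G) {lo hi : Fin d → ℤ} {a : ℝ} (hP : BoxPlaqSmall V lo hi a)
    (p : Fin d → ℤ) (l : Letter d) (μ : Fin d) (hl : l.1 ≠ μ) (h1 : lo ≤ p) (h2 : lo ≤ p + l.vec) (h3 : p + e μ ≤ hi)
    (h4 : p + l.vec + e μ ≤ hi) : dist1 (hol V p (lplaqWord l μ)) ≤ a := by
  obtain ⟨κ, b⟩ := l
  cases b
  · -- backward letter: conjugated inverse plaquette at `p - e κ`
    have hv : (Letter.vec ((κ, false) : Letter d)) = -e κ := rfl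
    have hid : hol V p (lplaqWord (κ, false) μ) =
        (V (p - e κ) κ)⁻¹ * (hol V (p - e κ) (plaqWord κ μ))⁻¹ * V (p - e κ) κ := by
      simp only [lplaqWord, plaqWord, hol_cons, hol_nil, mul_one, stepHol_true, stepHol_false, B7Prop1Explicit.Letter.rev_mk,
        Bool.not_false, B7Prop1Explicit.Letter.vec_true, B7Prop1Explicit.Letter.vec_false, mul_inv_rev, inv_inv]
      abel_nf
      group
    rw [hid, dist1_conj_inv, GaugeGroup.dist1_inv]
    rw [hv, ← sub_eq_add_neg] at h2 h4
    exact hP (p - e κ) κ μ hl h2 (by rwa [sub_add_cancel])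
  · rw [lplaqWord_true]
    exact hP p κ μ hl h1 h4

/-- ★★ **THE SHARP BOND BOUND IN THE TREE GAUGE ROOTED AT ANY POINT OF THE BOX** (`dist1` version, two-sided): for a root `r` and a
bond `⟨x, x + e_μ⟩` with `lo ≤ r ≤ hi`, `lo ≤ x`, `x + e_μ ≤ hi`, under `BoxPlaqSmall V lo hi a`:
`dist1 (V^{r}(x, x + e_μ)) ≤ (Σ_{κ<μ}|x_κ − r_κ|)·a` — B8's identity `axial_bond_eq_sharp` (any root) + pv26's located ladder with
every elementary loop placed inside the box by the walk lemma.
[cite: Balaban1985Averaging, pp.24–25; Balaban1985RegularSpaces, (1.129) p.98] -/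
theorem dist1_axial_bond_le_sharp_rooted (V : (Fin d → ℤ) → Fin d → G) {lo hi : Fin d → ℤ} {a : ℝ} (hP : BoxPlaqSmall V lo hi a)
    (r x : Fin d → ℤ) (μ : Fin d) (hr : lo ≤ r) (hr' : r ≤ hi) (hx : lo ≤ x) (hxμ : x + e μ ≤ hi) :
    dist1 (gaugeAct (axialFn V r) V x μ) ≤ l1 (lowPart μ (x - r)) * a := by
  set V₀ := gaugeAct (axialFn V r) V with hV₀
  set Lo : Fin d → ℤ := lowPart μ (x - r) with hLo
  set w : Fin d → ℤ := x - Lo with hw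
  set Q : List (Letter d) := treeWord Lo with hQ
  have hx' : x ≤ hi := (le_add_of_nonneg_right (e_nonneg μ)).trans hxμ
  have hid := axial_bond_eq_sharp V r x μ
  rw [← hV₀, ← hLo, ← hw, ← hQ] at hid
  have hQμ : ∀ l ∈ Q, l.1 ≠ μ := by
    intro l hl hlμ
    have h0 := ne_zero_of_mem_treeWord hl
    rw [hlμ, hLo, lowPart_apply, if_neg (lt_irrefl μ)] at h0
    exact h0 rfl
  -- coordinates of the start `w`: `r` below `μ`, `x` from `μ` on
  have hwi : ∀ i, w i = if i < μ then r i else x i := fun i => by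
    simp only [hw, hLo, Pi.sub_apply, lowPart_apply]; split_ifs <;> ring
  have hLoi : ∀ i, Lo i = if i < μ then x i - r i else 0 := fun i => by
    simp only [hLo, lowPart_apply, Pi.sub_apply]
  -- a point `between w and w + Lo` coordinatewise lies in `[lo, hi]`, with room `+e_μ` on top
  have hbox : ∀ q : Fin d → ℤ, (∀ i, min 0 (Lo i) ≤ q i ∧ q i ≤ max 0 (Lo i)) →
      lo ≤ w + q ∧ w + q + e μ ≤ hi := by
    intro q hq
    refine ⟨fun i => ?_, fun i => ?_⟩
    · obtain ⟨hq1, -⟩ := hq i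
      rw [Pi.add_apply, hwi]
      rw [hLoi] at hq1
      have := hr i; have := hx i
      split_ifs at hq1 ⊢ with hi
      · have : min 0 (x i - r i) ≤ q i := hq1
        rcases le_total 0 (x i - r i) with h0 | h0
        · rw [min_eq_left h0] at this; linarith
        · rw [min_eq_right h0] at this; linarith
      · simp at hq1; linarith
    · obtain ⟨-, hq2⟩ := hq i
      rw [Pi.add_apply, Pi.add_apply, hwi, e_apply]
      rw [hLoi] at hq2
      have := hr' i; have := hx' i; have hμ := hxμ i
      rw [Pi.add_apply, e_apply] at hμ
      split_ifs at hq2 hμ ⊢ with hi hiμ hiμ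
      · exact absurd (hiμ ▸ hi) (lt_irrefl _)
      · have : q i ≤ max 0 (x i - r i) := hq2
        rcases le_total 0 (x i - r i) with h0 | h0
        · rw [max_eq_right h0] at this; linarith
        · rw [max_eq_left h0] at this; linarith
      · simp at hq2; linarith
      · simp at hq2; linarith
  have hP' : ∀ (w₁ w₂ : List (Letter d)) (l : Letter d), Q = w₁ ++ l :: w₂ →
      dist1 (hol V₀ (w + disp w₁) (lplaqWord l μ)) ≤ a := by
    intro w₁ w₂ l hsplit
    have hl : l ∈ Q := by rw [hsplit]; simp
    obtain ⟨hb1, hb2⟩ := treeWord_split_between Lo hsplit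
    obtain ⟨h1, h3⟩ := hbox (disp w₁) hb1
    obtain ⟨h2, h4⟩ := hbox (disp w₁ + l.vec) hb2
    rw [← add_assoc] at h2 h4
    rw [hV₀, hol_gaugeAct_closed _ _ _ _ (disp_lplaqWord _ _), GaugeGroup.dist1_conj]
    exact dist1_hol_lplaqWord_le V hP _ l μ (hQμ l hl) h1 h2 h3 h4
  have hlad := dist1_hol_ladder_le_local V₀ μ Q w hQμ hP'
  rw [hid, dist1_conj_inv]
  refine hlad.trans (le_of_eq ?_)
  rw [hQ, length_treeWord]

/-- Global form with the `ℓ¹` distance to the root: `dist1 (V^{r}(x, x + e_μ)) ≤ |x − r|₁·a` (`0 ≤ a`).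
[cite: Balaban1985Averaging, pp.24–25; Balaban1985RegularSpaces, (1.129) p.98] -/
theorem dist1_axial_bond_le_rooted (V : (Fin d → ℤ) → Fin d → G) {lo hi : Fin d → ℤ} {a : ℝ} (hP : BoxPlaqSmall V lo hi a) (ha : 0 ≤ a)
    (r x : Fin d → ℤ) (μ : Fin d) (hr : lo ≤ r) (hr' : r ≤ hi) (hx : lo ≤ x) (hxμ : x + e μ ≤ hi) :
    dist1 (gaugeAct (axialFn V r) V x μ) ≤ l1 (x - r) * a := by
  refine (dist1_axial_bond_le_sharp_rooted V hP r x μ hr hr' hx hxμ).trans (mul_le_mul_of_nonneg_right ?_ ha)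
  rw [l1_lowPart_eq]
  unfold l1
  exact_mod_cast Finset.sum_le_sum fun κ _ => by split_ifs <;> simp

/-- The count: if every coordinate of `v` has absolute value `≤ h` then `Σ_{κ<μ}|v_κ| ≤ (d − 1)·h`.
[cite: Balaban1985Averaging, pp.24–25; Balaban1985RegularSpaces, (1.129) p.98] -/
theorem l1_lowPart_le_of_abs_le (μ : Fin d) {v : Fin d → ℤ} {h : ℕ} (hv : ∀ κ, |v κ| ≤ h) :
    l1 (lowPart μ v) ≤ (d - 1) * h := by
  rw [l1_lowPart_eq]
  calc ∑ κ, (if κ < μ then (v κ).natAbs else 0)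
      ≤ ∑ κ : Fin d, (if κ < μ then h else 0) := Finset.sum_le_sum fun κ _ => by
        split_ifs
        · have : ((v κ).natAbs : ℤ) ≤ h := by rw [Int.natCast_natAbs]; exact hv κ
          exact_mod_cast this
        · exact le_rfl
    _ = (μ : ℕ) * h := by
        rw [Finset.sum_ite, Finset.sum_const_zero, add_zero, Finset.sum_const, smul_eq_mul]
        congr 1
        rw [show (Finset.univ.filter fun κ : Fin d => κ < μ) = Finset.Iio μ by ext κ; simp, Fin.card_Iio]
    _ ≤ (d - 1) * h := Nat.mul_le_mul_right _ (by have := μ.isLt; omega)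

/-- THE UNIFORM TWO-SIDED TREE-GAUGE BOUND: if the bond's source is within sup-distance `h` of the root, `dist1 ≤ (d − 1)·h·a`
(`0 ≤ a`) — for a root at the centre of a box of side `n + 1`, `h = ⌈n∕2⌉` halves pv26's corner count `(d − 1)·n`.
[cite: Balaban1985Averaging, pp.24–25; Balaban1985RegularSpaces, (1.129) p.98] -/
theorem dist1_axial_bond_le_rooted_uniform (V : (Fin d → ℤ) → Fin d → G) {lo hi : Fin d → ℤ} {a : ℝ} {h : ℕ}
    (hP : BoxPlaqSmall V lo hi a) (ha : 0 ≤ a) (r x : Fin d → ℤ) (μ : Fin d) (hr : lo ≤ r) (hr' : r ≤ hi) (hx : lo ≤ x)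
    (hxμ : x + e μ ≤ hi) (hrad : ∀ κ, |x κ - r κ| ≤ h) :
    dist1 (gaugeAct (axialFn V r) V x μ) ≤ ((d - 1 : ℕ) : ℝ) * h * a := by
  refine (dist1_axial_bond_le_sharp_rooted V hP r x μ hr hr' hx hxμ).trans ?_
  have hcount := l1_lowPart_le_of_abs_le μ (v := x - r) (h := h) fun κ => by simpa using hrad κ
  exact mul_le_mul_of_nonneg_right (by exact_mod_cast hcount) ha

end GroupLevel

/-! ## §3  The torus: the axial gauge on a box rooted at any of its points -/

section Torus

variable {P : Params} {j : ℕ} {G : Type*} [GaugeGroup G]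

open Classical in
/-- THE AXIAL GAUGE TRANSFORMATION ON THE TORUS attached to the box `[lo, hi]` AND ROOTED AT `r`: `axialFn (pull U) r x` at the image
of a box point `x` (well defined on non-wrapping boxes), `1` off the image of the box; at `r = lo` it is pv26's `axialGauge U lo hi`.
[cite: Balaban1985Averaging, p.24 («v₀(x) := V(Γ_{y,x})»); Balaban1985Variational, (147) p.301] -/
noncomputable def axialGaugeAt (U : GaugeField P j G) (lo hi r : Fin P.d → ℤ) : GaugeTransf P j G := fun s =>
  if h : ∃ x : Fin P.d → ℤ, lo ≤ x ∧ x ≤ hi ∧ (castSite x : Site P j) = s then axialFn (pull U) r (Classical.choose h) else 1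

/-- On a non-wrapping box the rooted torus gauge transformation IS the `ℤ^d` axial gauge function rooted at `r`.
[cite: Balaban1985Variational, (147) p.301; Balaban1985RegularSpaces, (1.129) p.98] -/
theorem axialGaugeAt_castSite (U : GaugeField P j G) {lo hi : Fin P.d → ℤ} (r : Fin P.d → ℤ)
    (hN : ∀ κ, hi κ - lo κ < P.sitesPerDir j) {x : Fin P.d → ℤ} (hx : lo ≤ x) (hx' : x ≤ hi) :
    axialGaugeAt U lo hi r (castSite x) = axialFn (pull U) r x := by
  have h : ∃ x' : Fin P.d → ℤ, lo ≤ x' ∧ x' ≤ hi ∧ (castSite x' : Site P j) = castSite x := ⟨x, hx, hx', rfl⟩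
  rw [axialGaugeAt, dif_pos h]
  obtain ⟨h1, h2, h3⟩ := Classical.choose_spec h
  rw [castSite_injOn_box hN h1 h2 hx hx' h3]

/-- Off the image of the box the rooted gauge transformation is `1`.
[cite: Balaban1985Variational, (147) p.301; Balaban1985RegularSpaces, (1.129) p.98] -/
theorem axialGaugeAt_eq_one (U : GaugeField P j G) {lo hi : Fin P.d → ℤ} (r : Fin P.d → ℤ) {s : Site P j}
    (hs : ¬ ∃ x : Fin P.d → ℤ, lo ≤ x ∧ x ≤ hi ∧ (castSite x : Site P j) = s) : axialGaugeAt U lo hi r s = 1 := by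
  rw [axialGaugeAt, dif_neg hs]

/-- pv26's corner-rooted `axialGauge` is the rooted gauge at `r = lo`.
[cite: Balaban1985Variational, (147) p.301; Balaban1985RegularSpaces, (1.129) p.98] -/
theorem axialGauge_eq_axialGaugeAt (U : GaugeField P j G) (lo hi : Fin P.d → ℤ) : axialGauge U lo hi = axialGaugeAt U lo hi lo := by
  funext s
  simp only [axialGauge, axialGaugeAt]

/-- The torus gauge action of `axialGaugeAt` on a bond of the box is the `ℤ^d` gauge action of `axialFn … r` on the pullback.
[cite: Balaban1985Variational, (147) p.301; Balaban1985RegularSpaces, (1.129) p.98] -/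
theorem gaugeAct_axialGaugeAt_castSite (U : GaugeField P j G) {lo hi : Fin P.d → ℤ} (r : Fin P.d → ℤ)
    (hN : ∀ κ, hi κ - lo κ < P.sitesPerDir j) {x : Fin P.d → ℤ} {μ : Fin P.d} (hx : lo ≤ x) (hxμ : x + e μ ≤ hi) :
    GaugeField.gaugeAct (axialGaugeAt U lo hi r) U ⟨castSite x, μ⟩ = gaugeAct (axialFn (pull U) r) (pull U) x μ := by
  have hx' : x ≤ hi := (le_add_of_nonneg_right (e_nonneg μ)).trans hxμ
  have hlo' : lo ≤ x + e μ := hx.trans (le_add_of_nonneg_right (e_nonneg μ))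
  simp only [GaugeField.gaugeAct, PBond.tgt, gaugeAct, pull_apply]
  rw [← castSite_add_e, axialGaugeAt_castSite U r hN hx hx', axialGaugeAt_castSite U r hN hlo' hxμ]

/-- ★★ **THE TORUS NON-ABELIAN POINCARÉ LEMMA FOR AN INTERIOR ROOT (sharp count)**: if `dist1 (U(∂p)) < δ` for the plaquettes
of a non-wrapping box `[lo, hi]` (`S₀ ⊇ boxPlaqs lo hi`), then in the axial gauge rooted at any `r` of the box every bond
`⟨x, x + e_μ⟩` of the box satisfies `dist1 (U^{axialGaugeAt … r}(b)) ≤ (Σ_{κ<μ}|x_κ − r_κ|)·δ`.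
[cite: Balaban1985Variational, (147) p.301; Balaban1985RegularSpaces, (1.129) p.98] -/
theorem dist1_gaugeAct_axialGaugeAt_le (U : GaugeField P j G) {lo hi : Fin P.d → ℤ} {δ : ℝ} {S₀ : Set (Plaq P j)}
    (hS₀ : boxPlaqs lo hi ⊆ S₀) (hU : PlaqSmallOn S₀ δ U) (hN : ∀ κ, hi κ - lo κ < P.sitesPerDir j)
    {r : Fin P.d → ℤ} (hr : lo ≤ r) (hr' : r ≤ hi) {x : Fin P.d → ℤ} {μ : Fin P.d} (hx : lo ≤ x) (hxμ : x + e μ ≤ hi) :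
    dist1 (GaugeField.gaugeAct (axialGaugeAt U lo hi r) U ⟨castSite x, μ⟩) ≤ l1 (lowPart μ (x - r)) * δ := by
  rw [gaugeAct_axialGaugeAt_castSite U r hN hx hxμ]
  exact dist1_axial_bond_le_sharp_rooted (pull U) (boxPlaqSmall_pull U hS₀ hU) r x μ hr hr' hx hxμ

/-- The `ℓ¹` form: `dist1 ≤ |x − r|₁·δ` (`0 ≤ δ`).
[cite: Balaban1985Variational, (147) p.301; Balaban1985RegularSpaces, (1.129) p.98] -/
theorem dist1_gaugeAct_axialGaugeAt_le_l1 (U : GaugeField P j G) {lo hi : Fin P.d → ℤ} {δ : ℝ} {S₀ : Set (Plaq P j)}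
    (hS₀ : boxPlaqs lo hi ⊆ S₀) (hU : PlaqSmallOn S₀ δ U) (hδ : 0 ≤ δ) (hN : ∀ κ, hi κ - lo κ < P.sitesPerDir j)
    {r : Fin P.d → ℤ} (hr : lo ≤ r) (hr' : r ≤ hi) {x : Fin P.d → ℤ} {μ : Fin P.d} (hx : lo ≤ x) (hxμ : x + e μ ≤ hi) :
    dist1 (GaugeField.gaugeAct (axialGaugeAt U lo hi r) U ⟨castSite x, μ⟩) ≤ l1 (x - r) * δ := by
  rw [gaugeAct_axialGaugeAt_castSite U r hN hx hxμ]
  exact dist1_axial_bond_le_rooted (pull U) (boxPlaqSmall_pull U hS₀ hU) hδ r x μ hr hr' hx hxμ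

/-- **THE UNIFORM BOUND FOR AN INTERIOR ROOT**: if every bond source of interest is within sup-distance `h` of the root,
`dist1 (U^{axialGaugeAt … r}(b)) ≤ (d − 1)·h·δ` (`0 ≤ δ`) — with `r` the centre of a box of side `n + 1`, `h = ⌈n∕2⌉`.
[cite: Balaban1985Variational, (147) p.301; Balaban1985RegularSpaces, (1.129) p.98] -/
theorem dist1_gaugeAct_axialGaugeAt_le_uniform (U : GaugeField P j G) {lo hi : Fin P.d → ℤ} {δ : ℝ} {S₀ : Set (Plaq P j)} {h : ℕ}
    (hS₀ : boxPlaqs lo hi ⊆ S₀) (hU : PlaqSmallOn S₀ δ U) (hδ : 0 ≤ δ) (hN : ∀ κ, hi κ - lo κ < P.sitesPerDir j)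
    {r : Fin P.d → ℤ} (hr : lo ≤ r) (hr' : r ≤ hi) {x : Fin P.d → ℤ} {μ : Fin P.d} (hx : lo ≤ x) (hxμ : x + e μ ≤ hi)
    (hrad : ∀ κ, |x κ - r κ| ≤ h) :
    dist1 (GaugeField.gaugeAct (axialGaugeAt U lo hi r) U ⟨castSite x, μ⟩) ≤ ((P.d - 1 : ℕ) : ℝ) * h * δ := by
  rw [gaugeAct_axialGaugeAt_castSite U r hN hx hxμ]
  exact dist1_axial_bond_le_rooted_uniform (pull U) (boxPlaqSmall_pull U hS₀ hU) hδ r x μ hr hr' hx hxμ hrad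

/-- Tree bonds (relative to the root `r`) are EXACTLY `1` in the rooted axial gauge (no smallness needed).
[cite: Balaban1985Variational, (147) p.301; Balaban1985RegularSpaces, (1.129) p.98] -/
theorem gaugeAct_axialGaugeAt_eq_one (U : GaugeField P j G) {lo hi : Fin P.d → ℤ} (r : Fin P.d → ℤ)
    (hN : ∀ κ, hi κ - lo κ < P.sitesPerDir j) {x : Fin P.d → ℤ} {μ : Fin P.d} (hx : lo ≤ x) (hxμ : x + e μ ≤ hi)
    (htree : lowPart μ (x - r) = 0) : GaugeField.gaugeAct (axialGaugeAt U lo hi r) U ⟨castSite x, μ⟩ = 1 := by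
  rw [gaugeAct_axialGaugeAt_castSite U r hN hx hxμ]
  exact axial_treeBond_eq_one (pull U) r x μ htree

end Torus

end Literature.MathematicalPhysics.QuantumFieldTheory.Balaban1983to89.T4AxialGaugeRooted
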